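import Mathlib
import Literature.Computability.Complexity.BoolEncodings
import HarnessLib

/-!
# Cubic Gauss sums and the Kummer sector language

For a prime `p ≡ 1 (mod 3)` and a primitive root `r` mod `p`, the *cubic residue character*
`χ = χ_{p,r} : 𝔽_p → ℂ` is the multiplicative character of exact order `3` with `χ(r) = ω`,
`ω = e^{2πi/3}`; concretely `χ(0) = 0` and `χ(a) = ω^j` when `a^{(p-1)/3} = u^j`,
`u = r^{(p-1)/3}` (van Dam–Seroussi specify characters exactly this way, by a triple
`(p, g, α)`, here `g = r`, `α = (p-1)/3` [VanDamSeroussi2002, §2.1]).  The *cubic Gauss sum* is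
`g(χ) = Σ_{a=0}^{p-1} χ(a) e^{2πi a/p}` [IrelandRosen1990, Ch. 8 §2].  Classical facts proved here
from Mathlib's `gaussSum`/`jacobiSum` API:

* `cubicGaussSum_eq_gaussSum` : `g(χ)` is Mathlib's `gaussSum χ ZMod.stdAddChar`;
* `cubicGaussSum_mul_conj`, `norm_cubicGaussSum` : `g(χ) · conj g(χ) = p`, `|g(χ)| = √p`
  [IrelandRosen1990, Prop. 8.2.2 and its proof];
* `cubicGaussSum_pow_three` : `g(χ)³ = p · J(χ, χ)` [IrelandRosen1990, Cor. to Prop. 8.3.3];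
* `jacobiSum_cubicMulChar_primary` : `J(χ, χ) = a + bω` with `a ≡ -1`, `b ≡ 0 (mod 3)`, i.e.
  `J(χ, χ)` is a *primary* element of `ℤ[ω]` of norm `p` [IrelandRosen1990, Prop. 8.3.4].

Since `g(χ)³ = pπ` with `π = J(χ,χ)` a primary prime of `ℤ[ω]` above `p`, `g(χ) = ω^k ρ` for a
unique `k ∈ {0,1,2}`, `ρ` the principal cube root of `pπ`; equivalently (`existsUnique_sector`,
valid for any nonzero complex number) there is a unique `k : Fin 3` with
`arg (g(χ) ω^{-k}) ∈ (-π/3, π/3]`.  Determining this `k` — Kummer's *sector* — is Kummer's problem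
of 1846 [IrelandRosen1990, Ch. 9 §12]; the sectors are asymptotically equidistributed
[HeathBrownPatterson1979], and Matthews evaluated `g(χ)` by elliptic functions [Matthews1979];
no algorithm polynomial in `log p` is known, while a quantum computer estimates `arg g(χ)` in
polynomial time [VanDamSeroussi2002, Thm. 1, and §8 for the open classical question].

* `kummerSectorIndex p r : Fin 3` is that `k` (junk value `0` when the sum vanishes, which does not
  happen in the prime setting: `cubicGaussSum_ne_zero`), characterised by
  `kummerSectorIndex_eq_iff`;
* `KummerSector : Language Bool` is the decision problem `{⟨p, r, k⟩ : k = kummerSectorIndex p r}`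
  over Cook's alphabet, with the pairing/encoding conventions of
  `Literature.Computability.Complexity.BoolEncodings`; `KummerSector_eq` proves it equal to the
  inline set used by route item `KummerSectorMCSP` (QuantumAdvantage/InverterDequantization) and
  the idea card `kummer-sector-language`.

## Design notes

* `cubicChar p r : ZMod p → ℂ` is a TOTAL elementary `if`-cascade in `p r : ℕ` (junk outside the
  intended range), so that `cubicGaussSum` and `KummerSector` need no proof arguments and unfold
  literally to the route's inline text; `cubicMulChar h3 hr : MulChar (ZMod p) ℂ` (built with
  `MulChar.ofRootOfUnity`) is the same function as a multiplicative character
  (`cubicMulChar_apply`), available under `[Fact p.Prime]`, `p % 3 = 1`, `IsPrimitiveRoot r (p-1)`.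
* Deliberately NOT here: the identification `J(χ_π, χ_π) = π` of the primary prime with the
  character (`χ = χ_π ⇔ π ∣ r^{(p-1)/3} - ω` in `ℤ[ω]`) [IrelandRosen1990, Ch. 9 §4 Lemma 1], which
  needs the arithmetic of `ℤ[ω]`; cubic reciprocity; the Heath-Brown–Patterson equidistribution
  theorem.  None is needed to state the language (which is written without `J`).

## References

* K. Ireland, M. Rosen, *A Classical Introduction to Modern Number Theory*, 2nd ed., GTM 84,
  Springer 1990 (same numbering as the 1982 edition): Ch. 8 §§2–3 (Props. 8.2.2, 8.3.3, 8.3.4),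
  Ch. 9 §4 (Lemma 1, Corollary `g(χ_π)³ = pπ`), Ch. 9 §12 (Kummer's problem).
* W. van Dam, G. Seroussi, *Efficient quantum algorithms for estimating Gauss sums*,
  arXiv:quant-ph/0207131 (2002), §2.1, Thm. 1, §8.
* D. R. Heath-Brown, S. J. Patterson, J. reine angew. Math. 310 (1979) 111–130.
* C. R. Matthews, Invent. Math. 52 (1979) 163–185.
-/

namespace Literature.NumberTheory.GaussSums

/-! ### The cube root of unity `ω` -/

/-- `ω = e^{2πi/3}`, the primitive cube root of unity in the upper half plane.  (The same
constant, with the same body, exists as `Literature.NumberTheory.Sieve.CubicSieve.omega` in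
`Sieve/HeathBrownCubicRegulator.lean`, where it serves the complex embedding of `ℚ(∛2)`; it is
re-declared here — definitionally equal — because importing that module would put 46 Literature
files of analytic number theory (Dedekind zeta, the PID `ℤ[∛2]`, …) under this elementary file.
A common home would be a future `Literature/NumberTheory/Cyclotomic/` file.) [folklore] -/
noncomputable def omega : ℂ := Complex.exp (2 * Real.pi * Complex.I / 3)

/-- `ω` is a primitive cube root of unity. [folklore] -/
theorem omega_isPrimitiveRoot : IsPrimitiveRoot omega 3 := by
  simpa [omega] using Complex.isPrimitiveRoot_exp 3 (by norm_num)

/-- `ω³ = 1`. [folklore] -/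
theorem omega_pow_three : omega ^ 3 = 1 := omega_isPrimitiveRoot.pow_eq_one

/-- `ω ≠ 1`. [folklore] -/
theorem omega_ne_one : omega ≠ 1 := omega_isPrimitiveRoot.ne_one (by norm_num)

/-- `ω⁻¹ = ω²`. [folklore] -/
theorem omega_inv : omega⁻¹ = omega ^ 2 :=
  inv_eq_of_mul_eq_one_left (by rw [← pow_succ]; exact omega_pow_three)

/-- `ω² = -1 - ω` (from `1 + ω + ω² = 0`). [folklore] -/
theorem omega_sq : omega ^ 2 = -1 - omega := by
  have h := omega_isPrimitiveRoot.geom_sum_eq_zero (by norm_num : 1 < 3)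
  simp only [Finset.sum_range_succ, Finset.sum_range_zero, zero_add, pow_zero, pow_one] at h
  linear_combination h

/-- Every element of `ℤ[ω] ⊆ ℂ` is `c + dω` with `c d : ℤ`. [folklore] -/
theorem exists_int_int_of_mem_adjoin_omega {z : ℂ} (hz : z ∈ Algebra.adjoin ℤ {omega}) :
    ∃ c d : ℤ, z = c + d * omega := by
  rw [Algebra.adjoin_singleton_eq_range_aeval] at hz
  obtain ⟨P, rfl⟩ := hz
  change ∃ c d : ℤ, Polynomial.aeval omega P = c + d * omega
  induction P using Polynomial.induction_on' with
  | add P Q hP hQ =>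
    obtain ⟨c, d, hcd⟩ := hP
    obtain ⟨c', d', hcd'⟩ := hQ
    exact ⟨c + c', d + d', by rw [map_add, hcd, hcd']; push_cast; ring⟩
  | monomial n c =>
    obtain ⟨q, m, hm, rfl⟩ : ∃ q m, m < 3 ∧ n = 3 * q + m :=
      ⟨n / 3, n % 3, Nat.mod_lt _ (by norm_num), (Nat.div_add_mod n 3).symm⟩
    rw [Polynomial.aeval_monomial, pow_add, pow_mul, omega_pow_three, one_pow, one_mul,
      Algebra.algebraMap_eq_smul_one, zsmul_eq_mul, mul_one]
    interval_cases m
    · exact ⟨c, 0, by push_cast; ring⟩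
    · exact ⟨0, c, by push_cast; ring⟩
    · exact ⟨-c, -c, by rw [omega_sq]; push_cast; ring⟩

/-! ### The cubic residue character and the cubic Gauss sum (elementary, total form) -/

section Elementary

variable (p r : ℕ)

/-- The cubic residue character `χ_{p,r} : 𝔽_p → ℂ` attached to (a prime) `p ≡ 1 (mod 3)` and (a
primitive root) `r` mod `p`, as a total elementary function of `p r : ℕ` (junk outside that
range): `χ(0) = 0` and, for `a ≠ 0`, `χ(a) = 1, ω, ω²` according as `a^{(p-1)/3} = 1, u, u²`
where `u = r^{(p-1)/3}`; equivalently `χ(r^j) = ω^j` (`cubicMulChar_apply_pow`,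
`cubicMulChar_apply`).  This is the character `(p, g, α) = (p, r, (p-1)/3)` of
[cite: VanDamSeroussi2002, §2.1]; cf. Ireland–Rosen Ch. 8 §1, Prop. 9.3.3. -/
noncomputable def cubicChar (a : ZMod p) : ℂ :=
  if a = 0 then 0
  else if a ^ ((p - 1) / 3) = 1 then 1
  else if a ^ ((p - 1) / 3) = (r : ZMod p) ^ ((p - 1) / 3) then omega
  else omega ^ 2

/-- The cubic Gauss sum `g(χ_{p,r}) = Σ_{a=0}^{p-1} χ_{p,r}(a) e^{2πi a/p}` (total in `p r : ℕ`).
[cite: IrelandRosen1990, Ch. 8 §2 (g_a(χ) with a = 1)] -/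
noncomputable def cubicGaussSum : ℂ :=
  ∑ a ∈ Finset.range p, cubicChar p r a * Complex.exp (2 * Real.pi * Complex.I * a / p)

end Elementary

/-! ### The cubic character as a `MulChar` -/

section Character

variable {p r : ℕ} [hp : Fact p.Prime]

/-- A primitive root `r` mod a prime `p` generates the unit group of `ZMod p`. [folklore] -/
theorem forall_mem_zpowers_of_isPrimitiveRoot (hr : IsPrimitiveRoot (r : ZMod p) (p - 1)) :
    ∀ x : (ZMod p)ˣ, x ∈ Subgroup.zpowers (hr.isUnit (Nat.sub_ne_zero_of_lt hp.out.one_lt)).unit := by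
  have hu := hr.isUnit_unit (Nat.sub_ne_zero_of_lt hp.out.one_lt)
  have hcard : Nat.card (Subgroup.zpowers (hr.isUnit (Nat.sub_ne_zero_of_lt hp.out.one_lt)).unit)
      = Nat.card (ZMod p)ˣ := by
    rw [Nat.card_zpowers, ← hu.eq_orderOf, Nat.card_eq_fintype_card, ZMod.card_units]
  intro x
  rw [Subgroup.eq_top_of_card_eq _ hcard]
  exact Subgroup.mem_top x

/-- For `p ≡ 1 (mod 3)`, `ω` is a `#(ZMod p)ˣ`-th root of unity. [folklore] -/
theorem omega_mem_rootsOfUnity (h3 : p % 3 = 1) :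
    (omega_isPrimitiveRoot.isUnit three_ne_zero).unit ∈ rootsOfUnity (Fintype.card (ZMod p)ˣ) ℂ := by
  have h31 : 3 ∣ p - 1 := by have := hp.out.one_lt; omega
  obtain ⟨m, hm⟩ := h31
  rw [mem_rootsOfUnity, ZMod.card_units, Units.ext_iff, Units.val_pow_eq_pow_val,
    IsUnit.unit_spec, Units.val_one, hm, pow_mul, omega_pow_three, one_pow]

/-- The cubic residue character `χ_{p,r}` as a multiplicative character of `ZMod p`, for `p`
prime, `p ≡ 1 (mod 3)` and `r` a primitive root: the character sending the generator `r` of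
`(ZMod p)ˣ` to `ω = e^{2πi/3}` — Ireland–Rosen's `χ = λ^{(p-1)/n}`, `χ(g) = e^{2πi/n}` with `n = 3`,
`g = r` (a character of exact order `3`, `orderOf_cubicMulChar`).
[cite: IrelandRosen1990, Prop. 8.1.4 (proof) with n = 3] -/
noncomputable def cubicMulChar (h3 : p % 3 = 1) (hr : IsPrimitiveRoot (r : ZMod p) (p - 1)) :
    MulChar (ZMod p) ℂ :=
  MulChar.ofRootOfUnity (omega_mem_rootsOfUnity h3) (forall_mem_zpowers_of_isPrimitiveRoot hr)

/-- `χ_{p,r}(r) = ω`. [folklore] -/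
theorem cubicMulChar_apply_self (h3 : p % 3 = 1) (hr : IsPrimitiveRoot (r : ZMod p) (p - 1)) :
    cubicMulChar h3 hr r = omega := by
  have h := MulChar.ofRootOfUnity_spec (omega_mem_rootsOfUnity h3)
    (forall_mem_zpowers_of_isPrimitiveRoot hr)
  rwa [IsUnit.unit_spec, IsUnit.unit_spec] at h

/-- `χ_{p,r}(r^j) = ω^j`. [folklore] -/
theorem cubicMulChar_apply_pow (h3 : p % 3 = 1) (hr : IsPrimitiveRoot (r : ZMod p) (p - 1)) (j : ℕ) :
    cubicMulChar h3 hr ((r : ZMod p) ^ j) = omega ^ j := by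
  rw [map_pow, cubicMulChar_apply_self]

/-- `χ_{p,r}³ = 1`. [folklore] -/
theorem cubicMulChar_pow_three (h3 : p % 3 = 1) (hr : IsPrimitiveRoot (r : ZMod p) (p - 1)) :
    cubicMulChar h3 hr ^ 3 = 1 := by
  rw [MulChar.eq_iff (forall_mem_zpowers_of_isPrimitiveRoot hr), MulChar.pow_apply_coe,
    MulChar.one_apply_coe, IsUnit.unit_spec, cubicMulChar_apply_self, omega_pow_three]

/-- `χ_{p,r}` is nontrivial. [folklore] -/
theorem cubicMulChar_ne_one (h3 : p % 3 = 1) (hr : IsPrimitiveRoot (r : ZMod p) (p - 1)) :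
    cubicMulChar h3 hr ≠ 1 := by
  intro h
  have h' := congrArg (fun χ : MulChar (ZMod p) ℂ => χ (r : ZMod p)) h
  simp only [cubicMulChar_apply_self] at h'
  rw [MulChar.one_apply (hr.isUnit (Nat.sub_ne_zero_of_lt hp.out.one_lt))] at h'
  exact omega_ne_one h'

/-- `χ_{p,r}` has exact order `3`. [cite: IrelandRosen1990, Prop. 8.1.5 (proof: ε, χ, χ² are distinct)] -/
theorem orderOf_cubicMulChar (h3 : p % 3 = 1) (hr : IsPrimitiveRoot (r : ZMod p) (p - 1)) :
    orderOf (cubicMulChar h3 hr) = 3 :=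
  orderOf_eq_prime (cubicMulChar_pow_three h3 hr) (cubicMulChar_ne_one h3 hr)

/-- `χ_{p,r}(-1) = 1` (as `-1 = (-1)³`). [cite: IrelandRosen1990, Cor. to Prop. 8.3.3 (proof)] -/
theorem cubicMulChar_neg_one (h3 : p % 3 = 1) (hr : IsPrimitiveRoot (r : ZMod p) (p - 1)) :
    cubicMulChar h3 hr (-1) = 1 := by
  have h1 : (cubicMulChar h3 hr (-1)) ^ 3 = 1 := by
    rw [← MulChar.pow_apply' _ three_ne_zero, cubicMulChar_pow_three,
      MulChar.one_apply isUnit_one.neg]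
  have h2 : (cubicMulChar h3 hr (-1)) ^ 2 = 1 := by rw [← map_pow, neg_one_sq, map_one]
  rwa [pow_succ, h2, one_mul] at h1

/-- The multiplicative character `cubicMulChar` IS the elementary function `cubicChar`:
`χ(a) = 0, 1, ω, ω²` according as `a = 0`, `a^{(p-1)/3} = 1, u, u²` (`u = r^{(p-1)/3}`).
[cite: IrelandRosen1990, Prop. 9.3.3 (χ(α) ≡ α^{(p-1)/3}) and Prop. 7.1.2] -/
theorem cubicMulChar_apply (h3 : p % 3 = 1) (hr : IsPrimitiveRoot (r : ZMod p) (p - 1)) (a : ZMod p) :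
    cubicMulChar h3 hr a = cubicChar p r a := by
  unfold cubicChar
  by_cases ha : a = 0
  · rw [if_pos ha, ha]; exact MulChar.map_zero _
  rw [if_neg ha]
  have hp1 : p - 1 ≠ 0 := Nat.sub_ne_zero_of_lt hp.out.one_lt
  haveI : NeZero (p - 1) := ⟨hp1⟩
  have h31 : 3 ∣ p - 1 := by have := hp.out.one_lt; omega
  have hu : IsPrimitiveRoot ((r : ZMod p) ^ ((p - 1) / 3)) 3 :=
    hr.pow (Nat.pos_of_ne_zero hp1) (Nat.div_mul_cancel h31).symm
  obtain ⟨i, -, rfl⟩ := hr.eq_pow_of_pow_eq_one (ZMod.pow_card_sub_one_eq_one ha)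
  rw [cubicMulChar_apply_pow, ← pow_mul, Nat.mul_comm i ((p - 1) / 3), pow_mul]
  obtain ⟨q, m, hm, rfl⟩ : ∃ q m, m < 3 ∧ i = 3 * q + m :=
    ⟨i / 3, i % 3, Nat.mod_lt _ (by norm_num), (Nat.div_add_mod i 3).symm⟩
  have red : ∀ {M : Type} [Monoid M] (x : M), x ^ 3 = 1 → x ^ (3 * q + m) = x ^ m :=
    fun x hx => by rw [pow_add, pow_mul, hx, one_pow, one_mul]
  rw [red _ hu.pow_eq_one, red _ omega_pow_three]
  interval_cases m
  · simp
  · rw [pow_one, pow_one, if_neg (hu.ne_one (by norm_num)), if_pos rfl]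
  · have h2 : ((r : ZMod p) ^ ((p - 1) / 3)) ^ 2 ≠ 1 :=
      hu.pow_ne_one_of_pos_of_lt (by norm_num) (by norm_num)
    have h2' : ((r : ZMod p) ^ ((p - 1) / 3)) ^ 2 ≠ (r : ZMod p) ^ ((p - 1) / 3) := fun h => by
      have := hu.pow_inj (by norm_num : 2 < 3) (by norm_num : 1 < 3) (by rw [pow_one]; exact h)
      norm_num at this
    rw [if_neg h2, if_neg h2']

/-- The elementary cubic Gauss sum is Mathlib's `gaussSum` of `cubicMulChar` and the standard
additive character `a ↦ e^{2πi a/p}`. [cite: IrelandRosen1990, Ch. 8 §2] -/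
theorem cubicGaussSum_eq_gaussSum (h3 : p % 3 = 1) (hr : IsPrimitiveRoot (r : ZMod p) (p - 1)) :
    cubicGaussSum p r = gaussSum (cubicMulChar h3 hr) (ZMod.stdAddChar (N := p)) := by
  unfold cubicGaussSum gaussSum
  refine Finset.sum_nbij' (fun a : ℕ => (a : ZMod p)) ZMod.val (fun _ _ => Finset.mem_univ _)
    (fun a _ => Finset.mem_range.mpr (ZMod.val_lt a))
    (fun a ha => ZMod.val_natCast_of_lt (Finset.mem_range.mp ha))
    (fun a _ => ZMod.natCast_zmod_val a) (fun a _ => ?_)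
  rw [cubicMulChar_apply, ZMod.stdAddChar_apply, ZMod.toCircle_natCast]

/-- `g(χ) · conj g(χ) = p`. [cite: IrelandRosen1990, Prop. 8.2.2 (proof)] -/
theorem cubicGaussSum_mul_conj (h3 : p % 3 = 1) (hr : IsPrimitiveRoot (r : ZMod p) (p - 1)) :
    cubicGaussSum p r * (starRingEnd ℂ) (cubicGaussSum p r) = p := by
  rw [cubicGaussSum_eq_gaussSum h3 hr, starRingEnd_apply, star_gaussSum_eq,
    gaussSum_mul_gaussSum_eq_card (cubicMulChar_ne_one h3 hr) (ZMod.isPrimitive_stdAddChar p),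
    ZMod.card]

/-- `|g(χ)|² = p`. [cite: IrelandRosen1990, Prop. 8.2.2] -/
theorem normSq_cubicGaussSum (h3 : p % 3 = 1) (hr : IsPrimitiveRoot (r : ZMod p) (p - 1)) :
    Complex.normSq (cubicGaussSum p r) = p := by
  have h := cubicGaussSum_mul_conj h3 hr
  rw [Complex.mul_conj] at h
  exact_mod_cast h

/-- `|g(χ)| = √p`. [cite: IrelandRosen1990, Prop. 8.2.2] -/
theorem norm_cubicGaussSum (h3 : p % 3 = 1) (hr : IsPrimitiveRoot (r : ZMod p) (p - 1)) :
    ‖cubicGaussSum p r‖ = Real.sqrt p := by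
  rw [← Real.sqrt_sq (norm_nonneg _), ← Complex.normSq_eq_norm_sq, normSq_cubicGaussSum h3 hr]

/-- `g(χ) ≠ 0`. [cite: IrelandRosen1990, Prop. 8.2.2] -/
theorem cubicGaussSum_ne_zero (h3 : p % 3 = 1) (hr : IsPrimitiveRoot (r : ZMod p) (p - 1)) :
    cubicGaussSum p r ≠ 0 := by
  intro h
  have h' := normSq_cubicGaussSum h3 hr
  rw [h, map_zero] at h'
  exact hp.out.ne_zero (by exact_mod_cast h'.symm)

/-- `g(χ)³ = p · J(χ, χ)` for the cubic character. [cite: IrelandRosen1990, Cor. to Prop. 8.3.3] -/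
theorem cubicGaussSum_pow_three (h3 : p % 3 = 1) (hr : IsPrimitiveRoot (r : ZMod p) (p - 1)) :
    cubicGaussSum p r ^ 3 = p * jacobiSum (cubicMulChar h3 hr) (cubicMulChar h3 hr) := by
  have h := gaussSum_pow_eq_prod_jacobiSum (χ := cubicMulChar h3 hr) (ψ := ZMod.stdAddChar)
    (by rw [orderOf_cubicMulChar]; norm_num) (ZMod.isPrimitive_stdAddChar p)
  rw [orderOf_cubicMulChar] at h
  rw [cubicGaussSum_eq_gaussSum h3 hr, h, cubicMulChar_neg_one, ZMod.card, one_mul,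
    show Finset.Ico 1 (3 - 1) = {1} by rfl, Finset.prod_singleton, pow_one]

/-- `J(χ, χ) = a + bω` with `a ≡ -1 (mod 3)` and `b ≡ 0 (mod 3)`: the Jacobi sum of the cubic
character is a primary element of `ℤ[ω]` (of norm `p`, by `cubicGaussSum_pow_three` and
`normSq_cubicGaussSum`). [cite: IrelandRosen1990, Prop. 8.3.4] -/
theorem jacobiSum_cubicMulChar_primary (h3 : p % 3 = 1) (hr : IsPrimitiveRoot (r : ZMod p) (p - 1)) :
    ∃ a b : ℤ, jacobiSum (cubicMulChar h3 hr) (cubicMulChar h3 hr) = a + b * omega ∧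
      a ≡ -1 [ZMOD 3] ∧ b ≡ 0 [ZMOD 3] := by
  have h31 : 3 ∣ Fintype.card (ZMod p) - 1 := by rw [ZMod.card]; have := hp.out.one_lt; omega
  obtain ⟨z, hz, hJ⟩ := exists_jacobiSum_eq_neg_one_add (by norm_num : 2 < 3)
    (cubicMulChar_pow_three h3 hr) (cubicMulChar_pow_three h3 hr) h31 omega_isPrimitiveRoot
  obtain ⟨c, d, rfl⟩ := exists_int_int_of_mem_adjoin_omega hz
  refine ⟨-1 + 3 * d, 3 * (d - c), ?_, ?_, ?_⟩
  · rw [hJ]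
    push_cast
    linear_combination ((c : ℂ) - 2 * d) * omega_sq + (d : ℂ) * omega_pow_three
  · unfold Int.ModEq; omega
  · unfold Int.ModEq; omega

end Character

/-! ### Sectors: the unique `k` with `arg (z ω^{-k}) ∈ (-π/3, π/3]` -/

section Sector

/-- Rotation by `ω^{-k}` shifts the argument by `-2πk/3` modulo `2π`. [folklore] -/
theorem arg_mul_omega_inv_pow {z : ℂ} (hz : z ≠ 0) (k : ℕ) :
    Complex.arg (z * omega⁻¹ ^ k) =
      toIocMod Real.two_pi_pos (-Real.pi) (Complex.arg z - 2 * Real.pi * k / 3) := by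
  have hexp : z * omega⁻¹ ^ k =
      (‖z‖ : ℂ) * Complex.exp (↑(Complex.arg z - 2 * Real.pi * k / 3) * Complex.I) := by
    conv_lhs => rw [← Complex.norm_mul_exp_arg_mul_I z]
    rw [omega, ← Complex.exp_neg, ← Complex.exp_nat_mul, mul_assoc, ← Complex.exp_add]
    congr 2
    push_cast
    ring
  rw [hexp, Complex.arg_real_mul _ (norm_pos_iff.mpr hz), Complex.arg_exp_mul_I]

/-- Reduction modulo `2π` into `(-π, π]` is the identity there. [folklore] -/
private theorem toIocMod_of_mem {t : ℝ} (ht : t ∈ Set.Ioc (-Real.pi) Real.pi) :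
    toIocMod Real.two_pi_pos (-Real.pi) t = t := by
  rw [toIocMod_eq_self, show -Real.pi + 2 * Real.pi = Real.pi by ring]; exact ht

/-- Reduction modulo `2π` into `(-π, π]` of `t ∈ (-3π, -π]` is `t + 2π`. [folklore] -/
private theorem toIocMod_of_mem' {t : ℝ} (ht : t + 2 * Real.pi ∈ Set.Ioc (-Real.pi) Real.pi) :
    toIocMod Real.two_pi_pos (-Real.pi) t = t + 2 * Real.pi := by
  rw [← toIocMod_add_right, toIocMod_of_mem ht]

/-- The three sectors in terms of `arg z ∈ (-π, π]`: `k = 0 ↔ arg z ∈ (-π/3, π/3]`,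
`k = 1 ↔ arg z ∈ (π/3, π]`, `k = 2 ↔ arg z ∈ (-π, -π/3]`. [folklore] -/
theorem arg_mul_omega_inv_pow_mem_iff {z : ℂ} (hz : z ≠ 0) {k : ℕ} (hk : k < 3) :
    Complex.arg (z * omega⁻¹ ^ k) ∈ Set.Ioc (-(Real.pi / 3)) (Real.pi / 3) ↔
      (k = 0 ∧ -(Real.pi / 3) < Complex.arg z ∧ Complex.arg z ≤ Real.pi / 3) ∨
      (k = 1 ∧ Real.pi / 3 < Complex.arg z) ∨ (k = 2 ∧ Complex.arg z ≤ -(Real.pi / 3)) := by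
  have hπ := Real.pi_pos
  obtain ⟨h1, h2⟩ := Complex.arg_mem_Ioc z
  rw [arg_mul_omega_inv_pow hz]
  interval_cases k
  · rw [Nat.cast_zero, mul_zero, zero_div, sub_zero, toIocMod_of_mem ⟨h1, h2⟩, Set.mem_Ioc]
    constructor
    · rintro ⟨a, b⟩; exact Or.inl ⟨rfl, a, b⟩
    · rintro (⟨-, a, b⟩ | ⟨h, -⟩ | ⟨h, -⟩)
      · exact ⟨a, b⟩
      · exact absurd h (by norm_num)
      · exact absurd h (by norm_num)
  · rw [Nat.cast_one, mul_one]
    by_cases hθ : -(Real.pi / 3) < Complex.arg z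
    · rw [toIocMod_of_mem ⟨by linarith, by linarith⟩, Set.mem_Ioc]
      constructor
      · rintro ⟨a, -⟩; exact Or.inr (Or.inl ⟨rfl, by linarith⟩)
      · rintro (⟨h, -⟩ | ⟨-, a⟩ | ⟨h, -⟩)
        · exact absurd h (by norm_num)
        · exact ⟨by linarith, by linarith⟩
        · exact absurd h (by norm_num)
    · push Not at hθ
      rw [toIocMod_of_mem' ⟨by linarith, by linarith⟩, Set.mem_Ioc]
      constructor
      · rintro ⟨-, b⟩; linarith
      · rintro (⟨h, -⟩ | ⟨-, a⟩ | ⟨h, -⟩)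
        · exact absurd h (by norm_num)
        · linarith
        · exact absurd h (by norm_num)
  · rw [Nat.cast_ofNat]
    by_cases hθ : Real.pi / 3 < Complex.arg z
    · rw [toIocMod_of_mem ⟨by linarith, by linarith⟩, Set.mem_Ioc]
      constructor
      · rintro ⟨a, -⟩; linarith
      · rintro (⟨h, -⟩ | ⟨h, -⟩ | ⟨-, a⟩)
        · exact absurd h (by norm_num)
        · exact absurd h (by norm_num)
        · linarith
    · push Not at hθ
      rw [toIocMod_of_mem' ⟨by linarith, by linarith⟩, Set.mem_Ioc]
      constructor
      · rintro ⟨-, b⟩; exact Or.inr (Or.inr ⟨rfl, by linarith⟩)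
      · rintro (⟨h, -⟩ | ⟨h, -⟩ | ⟨-, a⟩)
        · exact absurd h (by norm_num)
        · exact absurd h (by norm_num)
        · exact ⟨by linarith, by linarith⟩

/-- For `z ≠ 0` there is exactly one `k : Fin 3` with `arg (z ω^{-k}) ∈ (-π/3, π/3]` (the three
half-open arcs of length `2π/3` partition the circle). [folklore] -/
theorem existsUnique_sector {z : ℂ} (hz : z ≠ 0) :
    ∃! k : Fin 3, Complex.arg (z * omega⁻¹ ^ (k : ℕ)) ∈ Set.Ioc (-(Real.pi / 3)) (Real.pi / 3) := by
  have hπ := Real.pi_pos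
  have key := fun k : Fin 3 => arg_mul_omega_inv_pow_mem_iff hz k.isLt
  rcases lt_or_ge (Real.pi / 3) (Complex.arg z) with h | h
  · refine ⟨1, (key 1).mpr (Or.inr (Or.inl ⟨rfl, h⟩)), fun k hk => ?_⟩
    rcases (key k).mp hk with ⟨_, -, h0⟩ | ⟨h1, -⟩ | ⟨_, h2⟩
    · linarith
    · exact Fin.ext h1
    · linarith
  rcases lt_or_ge (-(Real.pi / 3)) (Complex.arg z) with h' | h'
  · refine ⟨0, (key 0).mpr (Or.inl ⟨rfl, h', h⟩), fun k hk => ?_⟩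
    rcases (key k).mp hk with ⟨h0, -⟩ | ⟨_, h1⟩ | ⟨_, h2⟩
    · exact Fin.ext h0
    · linarith
    · linarith
  · refine ⟨2, (key 2).mpr (Or.inr (Or.inr ⟨rfl, h'⟩)), fun k hk => ?_⟩
    rcases (key k).mp hk with ⟨_, h0, -⟩ | ⟨_, h1⟩ | ⟨h2, -⟩
    · linarith
    · linarith
    · exact Fin.ext h2

end Sector

/-! ### The Kummer sector index and the Kummer sector language -/

open scoped Classical in
/-- Kummer's sector index of `(p, r)`: the unique `k : Fin 3` with
`arg (g(χ_{p,r}) · ω^{-k}) ∈ (-π/3, π/3]`, i.e. `g(χ_{p,r}) = ω^k ρ` with `arg ρ ∈ (-π/3, π/3]`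
(for `p ≡ 1 (3)` prime, `ρ` is the principal cube root of `pπ`, `π = J(χ,χ)`; the boundary is never
attained since `pπ` is not real).  Junk value `0` if no such `k` exists, which happens only when the
sum vanishes (`existsUnique_sector`, `cubicGaussSum_ne_zero`).  Which `k` occurs is Kummer's
problem [cite: IrelandRosen1990, Ch. 9 §12 (pp. 137–138 of the 1982 ed.)]. -/
noncomputable def kummerSectorIndex (p r : ℕ) : Fin 3 :=
  if h : ∃ k : Fin 3, Complex.arg (cubicGaussSum p r * omega⁻¹ ^ (k : ℕ)) ∈
      Set.Ioc (-(Real.pi / 3)) (Real.pi / 3)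
  then h.choose else 0

/-- Defining property of the sector index (whenever the Gauss sum is nonzero). [folklore] -/
theorem kummerSectorIndex_spec {p r : ℕ} (h : cubicGaussSum p r ≠ 0) :
    Complex.arg (cubicGaussSum p r * omega⁻¹ ^ (kummerSectorIndex p r : ℕ)) ∈
      Set.Ioc (-(Real.pi / 3)) (Real.pi / 3) := by
  have hex := (existsUnique_sector h).exists
  rw [kummerSectorIndex, dif_pos hex]
  exact hex.choose_spec

/-- Characterisation of the sector index by its defining property. [folklore] -/
theorem kummerSectorIndex_eq_iff {p r : ℕ} (h : cubicGaussSum p r ≠ 0) (k : Fin 3) :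
    kummerSectorIndex p r = k ↔
      Complex.arg (cubicGaussSum p r * omega⁻¹ ^ (k : ℕ)) ∈ Set.Ioc (-(Real.pi / 3)) (Real.pi / 3) :=
  ⟨fun hk => hk ▸ kummerSectorIndex_spec h,
    fun hk => (existsUnique_sector h).unique (kummerSectorIndex_spec h) hk⟩

open Literature.Computability.Complexity (boolPair) in
/-- KUMMER'S SECTOR LANGUAGE over Cook's alphabet: the set of encodings
`⟨p, r, k⟩ = boolPair (encodeNat p) (boolPair (encodeNat r) (encodeNat k))` with `p` prime,
`p ≡ 1 (mod 3)`, `r` a primitive root mod `p` (`IsPrimitiveRoot (r : ZMod p) (p-1)`), `k < 3` and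
`k` = Kummer's sector of the cubic Gauss sum `g(χ_{p,r})`, i.e. `arg (g(χ_{p,r}) ω^{-k}) ∈ (-π/3, π/3]`
(`KummerSector_eq`).  Deciding it per prime is Kummer's problem [cite: IrelandRosen1990, Ch. 9 §12];
its argument-estimation form is solved in quantum polynomial time by van Dam–Seroussi
(arXiv:quant-ph/0207131, Thm. 1), whose §8 asks whether it is classically hard. -/
def KummerSector : Language Bool :=
  {w : List Bool | ∃ p r k : ℕ,
    w = boolPair (Computability.encodeNat p) (boolPair (Computability.encodeNat r)
      (Computability.encodeNat k)) ∧
    p.Prime ∧ p % 3 = 1 ∧ IsPrimitiveRoot (r : ZMod p) (p - 1) ∧ k < 3 ∧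
    (kummerSectorIndex p r : ℕ) = k}

/-- Membership in `KummerSector` in terms of the argument of the cubic Gauss sum. [folklore] -/
theorem mem_KummerSector_iff (w : List Bool) :
    w ∈ KummerSector ↔ ∃ p r k : ℕ,
      w = Literature.Computability.Complexity.boolPair (Computability.encodeNat p)
        (Literature.Computability.Complexity.boolPair (Computability.encodeNat r)
          (Computability.encodeNat k)) ∧
      p.Prime ∧ p % 3 = 1 ∧ IsPrimitiveRoot (r : ZMod p) (p - 1) ∧ k < 3 ∧
      Complex.arg (cubicGaussSum p r * omega⁻¹ ^ k) ∈ Set.Ioc (-(Real.pi / 3)) (Real.pi / 3) := by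
  refine exists_congr fun p => exists_congr fun r => exists_congr fun k => and_congr_right fun _ =>
    and_congr_right fun hp => and_congr_right fun h3 => and_congr_right fun hr =>
    and_congr_right fun hk => ?_
  haveI := Fact.mk hp
  simpa [Fin.ext_iff] using kummerSectorIndex_eq_iff (cubicGaussSum_ne_zero h3 hr) ⟨k, hk⟩

/-- `KummerSector` is LITERALLY the inline set of route item `KummerSectorMCSP`
(QuantumAdvantage/InverterDequantization, `stmt-QuantumAdvantage-1607`): unfold `cubicGaussSum`,
`cubicChar`, `omega`. [folklore] -/
theorem KummerSector_eq :
    KummerSector = ({w : List Bool | ∃ p r k : ℕ, w = Literature.Computability.Complexity.boolPair (Computability.encodeNat p) (Literature.Computability.Complexity.boolPair (Computability.encodeNat r) (Computability.encodeNat k)) ∧ p.Prime ∧ p % 3 = 1 ∧ IsPrimitiveRoot (r : ZMod p) (p - 1) ∧ k < 3 ∧ Complex.arg ((Finset.range p).sum (fun a : ℕ => (if (a : ZMod p) = 0 then (0 : ℂ) else if (a : ZMod p) ^ ((p - 1) / 3) = 1 then (1 : ℂ) else if (a : ZMod p) ^ ((p - 1) / 3) = (r : ZMod p) ^ ((p -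 1) / 3) then Complex.exp (2 * Real.pi * Complex.I / 3) else Complex.exp (2 * Real.pi * Complex.I / 3) ^ 2) * Complex.exp (2 * Real.pi * Complex.I * a / p)) * (Complex.exp (2 * Real.pi * Complex.I / 3))⁻¹ ^ k) ∈ Set.Ioc (-(Real.pi / 3)) (Real.pi / 3)} : Language Bool) := by
  ext w
  exact mem_KummerSector_iff w

end Literature.NumberTheory.GaussSums
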